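import Literature.AlgebraicGeometry.HodgeTheory.SubvariationIrreducibleOfFlatSpan
import Mathlib.Analysis.Calculus.ContDiff.Basic
import Mathlib.Analysis.Convex.PathConnected
import Mathlib.LinearAlgebra.Dual.Lemmas
import HarnessLib

/-!
# The flat-span condition (FS)_s from a finite jet-span certificate

Family `hodge`, layer `Literature/AlgebraicGeometry/HodgeTheory`; THEOREMS ONLY. The criterion
`isTransportIrreducible_of_flatSpan` ∕ `eq_bot_or_eq_of_stable_of_flatSpan`
(`SubvariationIrreducibleOfFlatSpan.lean`) consumes the germ condition (FS)_s: «for every proper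
subspace `P ⊊ M` and every open `W ∋ s` some member `t ∈ W`, joined to `s` inside `W`, has its
pulled-back line `M ∩ F^p(X_t)` outside `P`». This file reduces (FS)_s to a FINITE-RANK statement at
ONE member, the shape an exact computation can certify (the cell's «JetSpan» certificate, memo
`ROUTE-P3v28-g37.md` (C44)∕(C53)): if, in a chart `ψ` of the base near `s`, there is a map
`ω : ℂ^d → ℂ ⊗_ℚ Hᵏ(X_s; ℚ)` taking at every nearby member `t` a value in `M ∩ F^p(X_t)` (pulled back to
`s` by rational transport inside the chart neighbourhood), and the iterated derivatives of `ω` at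
`ψ s` up to some order `r` SPAN `M` — stated dually: every linear functional killing all
`D^i(φ ∘ ω)(ψ s)`, `i ≤ r`, kills `M` — then (FS)_s holds (`flatSpan_of_jetSpan`). The proof is the
elementary remark behind Voisin I §10.2 ∕ Griffiths' infinitesimal period relations: a map with values
in a closed subspace `P` on a neighbourhood of `ψ s` has all its Taylor coefficients in `P`
(`Filter.EventuallyEq.iteratedFDeriv`), so a functional killing `P` but not `M`
(`Submodule.exists_dual_map_eq_bot_of_notMem`) contradicts the jet-span hypothesis; the members near
`s` are reached along chart images of segments (`Convex.isPathConnected`, `IsPathConnected.image'`).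
No analyticity is assumed (the consumer supplies the derivatives it certifies); no named fact.

## References
* [VoisinHodgeI2002] C. Voisin, Hodge Theory and Complex Algebraic Geometry I, CUP 2002: §10.2.1
  Thm. 10.3, §10.2.2–10.2.3 (infinitesimal study of the period map), §9.3.1 Prop. 9.20.
* [Griffiths1968PeriodsII] P. Griffiths, Periods of integrals on algebraic manifolds II, Amer. J.
  Math. 90 (1968), §1.
-/

noncomputable section

open CategoryTheory AlgebraicGeometry
open _root_.Topology _root_.Filter Set Module Submodule
open scoped TensorProduct
open Literature.AlgebraicTopology.SingularHomology
open Literature.AlgebraicGeometry.Motives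

namespace Literature.AlgebraicGeometry.HodgeTheory

section HodgeTheory

variable {𝒳 S : SchemeOver ℂ}

/-- **(FS)_s from a jet-span certificate.** `f : 𝒳 → S` smooth projective of relative dimension `n`,
`Rᵏ f_* ℂ` locally trivial (`hU`), Hodge models `A t` with Hodge symmetry, base point `s`,
`Mi ⊆ ℂ ⊗_ℚ Hᵏ(X_s; ℚ)`, `p : ℤ`; a chart `ψ` of `S(ℂ)` with an open `W₀ ∋ s` inside its source; a map
`ω : ℂ^d → ℂ ⊗_ℚ Hᵏ(X_s; ℚ)` with `ω (ψ t) ∈ Mi ∩ F^p(t, T)` for every member `t ∈ W₀`, every path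
`s ⇝ t` inside `W₀` and every rational transport `T` along it (`F^p(t,T)` = the Hodge filtration of
`X_t` pulled back to `s` by `T`); JET SPAN: every `ℂ`-linear functional `φ` with
`D^i(φ ∘ ω)(ψ s) = 0` for all `i ≤ r` vanishes on `Mi`. THEN (FS)_s: for every proper `P ⊊ Mi` and every
open `W ∋ s` there are `t ∈ W`, a path `s ⇝ t` inside `W`, such that for every rational transport `T`
along it `Mi ∩ F^p(t,T) ⊄ P`. [cite: VoisinHodgeI2002, §10.2.1 Thm. 10.3 and §10.2.3]
[cite: Griffiths1968PeriodsII, §1] -/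
theorem flatSpan_of_jetSpan (f : 𝒳 ⟶ S) (n k d : ℕ) (hf : IsSmoothProjectiveFamily f n)
    (hU : IsCohomologicallyLocallyTrivialOn f (Set.univ : Set (ComplexPoints S)))
    (A : ∀ t : ComplexPoints S, HodgeModel n (fiberOver f t)) (hA : ∀ t, (A t).IsHodgeSymmetric)
    (s : (Set.univ : Set (ComplexPoints S)))
    (Mi : Submodule ℂ (ℂ ⊗[ℚ] bettiCohomology (fiberOver f s.1) k)) (p : ℤ)
    (ψ : OpenPartialHomeomorph (Set.univ : Set (ComplexPoints S)) (Fin d → ℂ))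
    (W₀ : Set (Set.univ : Set (ComplexPoints S))) (hW₀o : IsOpen W₀) (hsW₀ : s ∈ W₀)
    (hW₀ψ : W₀ ⊆ ψ.source)
    (ω : (Fin d → ℂ) → ℂ ⊗[ℚ] bettiCohomology (fiberOver f s.1) k)
    (hω : ∀ t ∈ W₀, ∀ (ε : Path s t), (∀ r', ε r' ∈ W₀) →
      ∀ (T : bettiCohomology (fiberOver f s.1) k ≃ₗ[ℚ] bettiCohomology (fiberOver f t.1) k),
        (∀ v, ofRatClass _ k (T v) = transportFun f k hU ⟦ε⟧ (ofRatClass _ k v)) →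
        ω (ψ t) ∈ Mi ⊓ (((A t.1).hodgeStructure (hf.isSmoothProjective t.1) (hA t.1) k).comapEquiv T).F p)
    (r : ℕ)
    (hjet : ∀ φ : Module.Dual ℂ (ℂ ⊗[ℚ] bettiCohomology (fiberOver f s.1) k),
      (∀ i ≤ r, iteratedFDeriv ℂ i (fun z ↦ φ (ω z)) (ψ s) = 0) → ∀ m ∈ Mi, φ m = 0) :
    ∀ P : Submodule ℂ (ℂ ⊗[ℚ] bettiCohomology (fiberOver f s.1) k), P < Mi →
      ∀ W : Set (Set.univ : Set (ComplexPoints S)), IsOpen W → s ∈ W →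
        ∃ t ∈ W, ∃ ε : Path s t, (∀ r', ε r' ∈ W) ∧
          ∀ (T : bettiCohomology (fiberOver f s.1) k ≃ₗ[ℚ] bettiCohomology (fiberOver f t.1) k),
            (∀ v, ofRatClass _ k (T v) = transportFun f k hU ⟦ε⟧ (ofRatClass _ k v)) →
            ¬ (Mi ⊓ (((A t.1).hodgeStructure (hf.isSmoothProjective t.1) (hA t.1) k).comapEquiv T).F p
                  ≤ P) := by
  intro P hP W hWo hsW
  by_contra hcon
  push Not at hcon
  -- a functional killing `P` but not `Mi`
  obtain ⟨m, hmM, hmP⟩ := SetLike.exists_of_lt hP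
  obtain ⟨φ, hφm, hφP⟩ := Submodule.exists_dual_map_eq_bot_of_notMem hmP inferInstance
  -- a ball around `ψ s` inside `ψ(W ∩ W₀)`
  have hs_src : s ∈ ψ.source := hW₀ψ hsW₀
  have hUo : IsOpen (ψ.target ∩ ψ.symm ⁻¹' (W ∩ W₀)) := ψ.isOpen_inter_preimage_symm (hWo.inter hW₀o)
  have hψsU : ψ s ∈ ψ.target ∩ ψ.symm ⁻¹' (W ∩ W₀) := by
    refine ⟨ψ.map_source hs_src, ?_⟩
    rw [mem_preimage, ψ.left_inv hs_src]
    exact ⟨hsW, hsW₀⟩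
  obtain ⟨δ, hδ, hball⟩ := Metric.isOpen_iff.1 hUo (ψ s) hψsU
  -- `φ ∘ ω` vanishes on the ball: each of its points is a member reached inside `W ∩ W₀`
  have hzero : ∀ z ∈ Metric.ball (ψ s) δ, φ (ω z) = 0 := by
    intro z hz
    have hzU := hball hz
    have hBpc : IsPathConnected (Metric.ball (ψ s) δ) :=
      (convex_ball (ψ s) δ).isPathConnected ⟨ψ s, Metric.mem_ball_self hδ⟩
    have himg : IsPathConnected (ψ.symm '' Metric.ball (ψ s) δ) :=
      hBpc.image' (ψ.continuousOn_symm.mono fun z' hz' ↦ (hball hz').1)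
    have hs' : s ∈ ψ.symm '' Metric.ball (ψ s) δ := ⟨ψ s, Metric.mem_ball_self hδ, ψ.left_inv hs_src⟩
    have ht' : ψ.symm z ∈ ψ.symm '' Metric.ball (ψ s) δ := ⟨z, hz, rfl⟩
    have hjoin : JoinedIn (ψ.symm '' Metric.ball (ψ s) δ) s (ψ.symm z) := himg.joinedIn s hs' _ ht'
    have hεWW₀ : ∀ r', hjoin.somePath r' ∈ W ∩ W₀ := fun r' ↦ by
      obtain ⟨z', hz', hz'eq⟩ := hjoin.somePath_mem r'
      rw [← hz'eq]
      exact (hball hz').2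
    obtain ⟨T, hT, hle⟩ := hcon (ψ.symm z) hzU.2.1 hjoin.somePath fun r' ↦ (hεWW₀ r').1
    have hmem := hω (ψ.symm z) hzU.2.2 hjoin.somePath (fun r' ↦ (hεWW₀ r').2) T hT
    rw [ψ.right_inv hzU.1] at hmem
    have hφ : φ (ω z) ∈ P.map φ := Submodule.mem_map_of_mem (hle hmem)
    rw [hφP] at hφ
    exact (Submodule.mem_bot ℂ).1 hφ
  -- hence all derivatives of `φ ∘ ω` at `ψ s` vanish
  have hderiv : ∀ i ≤ r, iteratedFDeriv ℂ i (fun z ↦ φ (ω z)) (ψ s) = 0 := by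
    intro i _
    have hev : (fun z ↦ φ (ω z)) =ᶠ[𝓝 (ψ s)] fun _ ↦ (0 : ℂ) :=
      Filter.eventuallyEq_of_mem (Metric.ball_mem_nhds (ψ s) hδ) hzero
    rw [(hev.iteratedFDeriv ℂ i).self_of_nhds, iteratedFDeriv_fun_zero]
    rfl
  exact hφm (hjet φ hderiv m hmM)

end HodgeTheory

end Literature.AlgebraicGeometry.HodgeTheory

end
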